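import Mathlib
import HarnessLib
import Summits.Parity.BatemanHorn.Theses.OddParityLadder

/-!
# Route `OddParityLadder`, glue item `OddGlueGlue` (split gen 1 of the residual leaf `OddGlue`, item stmt-Parity-29295)

The glue of the decomp-parity node B1.1.1.1 «GaussianThinning» (lens-1 g4; critic CLEARED HOME/STATUS.md
l.202, CRITIC-LEDGER row 45; filed as `ledger route edit --split OddGlue` = route rev 2):
`GaussThin → ThinGlue → OddGlue`.  `ThinGlue` (stmt-Parity-29294) is literally `OddGlue` (stmt-Parity-28277)
with ONE extra hypothesis — "if the system is the cell `E = ![X² + 1]` then `GaussThin`" — inserted before the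
conclusion, and `GaussThin` (stmt-Parity-29293) discharges that hypothesis outright; so the glue is two lines
of logic (the lens kernel's `oddGlue_of_thin`, HOME/decomp-parity-lens-1/g4/GaussianThinning.lean).  Hand by
the census seat (decomp-parity census-1 g6); no mathematics beyond the route file.
-/

namespace Summit.Parity.BatemanHorn.Theses.OddParityLadder

/-- **`OddGlueGlue` holds** (item stmt-Parity-29295): `GaussThin → ThinGlue → OddGlue` — feed `OddGlue`'s
hypotheses to `ThinGlue` and discharge its extra cell hypothesis by `GaussThin`. -/
theorem oddGlueGlue_holds : OddGlueGlue :=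
  fun hT hThin k f hf hex hC hO => hThin k f hf hex hC hO (fun _ => hT)

end Summit.Parity.BatemanHorn.Theses.OddParityLadder
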